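import Literature.Analysis.FluidPDE.TorusNSVDataExistenceApprox
import Literature.Analysis.FluidPDE.TorusNSVDataExistenceWindows
import HarnessLib

/-!
# Strong solutions of the forced Navier–Stokes system on `T³` from `V`-data by smooth
# approximation: classical on `(0, T]`, attaining the datum in `H¹`

Analysis/FluidPDE proof file (theorems only; no definitions, no named facts): the local existence
theorem for strong solutions in the classical vocabulary `Torus.IsClassicalNSSolutionOn`
(Robinson–Rodrigo–Sadowski 2016, Thm 6.8: for `u₀ ∈ V` a strong solution exists on `[0, T]`,
`T = T(‖∇u₀‖)`, as the limit of the solutions issued from the Galerkin truncations; Thm 7.5: it is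
smooth for `t > 0`), for the forced system NS_ν(F) near a classical background solution `(ū, p̄)`
on `[0, L]` (the force is absorbed by the background) with a force of finite Gevrey levels (a
trigonometric polynomial, `Torus.realTrigPoly_gevreyLevel_freqBall_le`). Main theorem
`Torus.IsClassicalNSSolutionOn.exists_forced_solution_of_eGradNormSq_le`: on `T^d`, `card d = 3`,
`ν > 0`, `E₁ ≥ 0`, there are `T ∈ (0, L]` and `Y` such that every `v₀ ∈ L²`, weakly divergence
free, mean zero, with spectral enstrophy `‖∇v₀‖₂² ≤ E₁` is attained in `L²` and in `Ḣ¹` as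
`t → 0⁺` by a classical solution `(u, p)` of NS_ν(F) on `(0, T] × T^d` with mean-zero slices,
`‖∇u(t)‖₂² ≤ 2E₁ + 2` and `∫ₛᵀ ‖Δu‖₂² ≤ Y` for all `s ∈ (0, T]`.

THE ARGUMENT. `T₀ = min (min T₆ T₂) (L/2)` with `T₆` the span of the continuation theorem
`exists_forced_solution_of_gradNormSq_le` at level `E₁` and `T₂` the `V`-lifespan
(`enstrophy_lifespan`); `T = T₀/2`. The truncations `v_N = P_N v₀` are smooth, divergence free,
mean zero with `‖∇v_N‖₂² ≤ E₁`, so they launch classical `U_N` on `[0, T₀]` with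
`‖∇U_N‖₂² ≤ 2E₁ + 1`, `∫₀ᵗ ‖ΔU_N‖² ≤ Y`; by `V`-stability
(`h1_sub_le_mul_of_integral_laplacian_sq_le`) and the Cauchy modulus of the truncations
(`Torus.h1DistSq_fourierTruncate_le`) the `U_N(t)` are `H¹`-Cauchy uniformly in `t`; the limit
slices `u(t)` (`Torus.exists_limit_slices_of_h1Cauchy`) solve the equations on `(0, T₀)`
(`exists_pressure_of_limit_slices`), and we restrict to `(0, T]`. The dissipation budget on
`[s, T]` is `⌈T/T₂'⌉ Y'` by `enstrophy_lifespan` at level `2E₁ + 1` from every `s`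
(`Torus.intervalIntegral_le_mul_of_forall_le`); the datum is attained by an `ε/3` argument through
`U_N(t)` and `v_N` (rate `2Cε_N`, continuity of `U_N` at `t = 0`, `ε_N → 0`).
Deliberately NOT here: uniqueness in this class and continuity into `V` at later times
(`TorusClassicalNSVStability`), the blow-up alternative, `d = 2`.

## Tree search

Searched `exists_forced_solution|eGradNormSq_le.*IsClassicalNSSolutionOn|VData`: only the
smooth-data theorems `exists_forced_solution_of_gradNormSq_le` (`TorusClassicalNSContinuation`) and
`Torus.exists_classicalNS_smooth` (`TorusNSSmoothLocalExistence`). Reused: those of the imports.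

## References

* J. C. Robinson, J. L. Rodrigo, W. Sadowski, *The Three-Dimensional Navier–Stokes Equations*,
  CUP 2016, Thm 6.8, Thm 7.5, §8.1. [RobinsonRodrigoSadowskiCUP2016]
* P. Constantin, C. Foias, *Navier–Stokes Equations*, Univ. Chicago Press 1988, Ch. 10.
  [ConstantinFoiasNSE1988]
-/

noncomputable section

open MeasureTheory Set Function Filter UnitAddTorus
open scoped ContDiff InnerProductSpace Topology ENNReal

namespace Literature.Analysis.FluidPDE

open Literature.Analysis.FunctionSpaces

variable {d : Type*} [Fintype d] [DecidableEq d]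

/-! ### Iterating a windowed integral bound -/

/-- **A windowed integral bound iterates**: if `∫ₛᵗ g ≤ Y` whenever `0 < s ≤ t ≤ T`, `t ≤ s + T₂`,
with `Y ≥ 0`, `T₂ > 0`, and `g` is interval integrable on every `[s, T]`, `0 < s ≤ T`, then
`∫ₛᵀ g ≤ n Y` for `0 < s ≤ T` with `T − s ≤ n T₂` (split `[s, T]` at `s + T₂` and induct). [folklore] -/
theorem Torus.intervalIntegral_le_mul_of_forall_le {g : ℝ → ℝ} {T T₂ Y : ℝ} (hT₂ : 0 < T₂) (hY : 0 ≤ Y)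
    (hg : ∀ s ∈ Ioc 0 T, IntervalIntegrable g volume s T)
    (hstep : ∀ s ∈ Ioc 0 T, ∀ t ∈ Icc s T, t ≤ s + T₂ → ∫ r in s..t, g r ≤ Y) (n : ℕ) :
    ∀ s ∈ Ioc 0 T, T - s ≤ n * T₂ → ∫ r in s..T, g r ≤ n * Y := by
  induction n with
  | zero =>
    intro s hs hn
    have hsT : s = T := le_antisymm hs.2 (by simpa using hn)
    subst hsT
    simp
  | succ n ih =>
    intro s hs hn
    by_cases hT : T ≤ s + T₂
    · have h := hstep s hs T ⟨hs.2, le_rfl⟩ hT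
      have h2 : Y ≤ (↑(n + 1) : ℝ) * Y := by
        have : (1 : ℝ) ≤ (↑(n + 1) : ℝ) := by exact_mod_cast Nat.succ_pos n
        nlinarith
      exact h.trans h2
    · push Not at hT
      have hs' : s + T₂ ∈ Ioc 0 T := ⟨by linarith [hs.1], hT.le⟩
      have hn' : T - (s + T₂) ≤ n * T₂ := by push_cast at hn; linarith
      have h1 := hstep s hs (s + T₂) ⟨by linarith, hT.le⟩ le_rfl
      have h2 := ih (s + T₂) hs' hn'
      have hi1 : IntervalIntegrable g volume s (s + T₂) :=
        (hg s hs).mono_set (by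
          rw [uIcc_of_le hs.2, uIcc_of_le (by linarith)]
          exact Icc_subset_Icc le_rfl hT.le)
      rw [← intervalIntegral.integral_add_adjacent_intervals hi1 (hg _ hs')]
      push_cast
      linarith

/-! ### The main theorem -/

/-- **Strong solutions of the forced Navier–Stokes system on `T³` from `V`-data, classical on
`(0, T]` and attaining the datum in `H¹`** (Robinson–Rodrigo–Sadowski 2016, Thm 6.8 with Thm 7.5,
for NS_ν(F) with the force absorbed by a background solution). On `T^d` with `card d = 3`, let
`ν > 0`, `F` a force of finite Gevrey levels (e.g. a trigonometric polynomial), `L > 0`, `(ū, p̄)` a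
classical solution of NS_ν(F) on `[0, L] × T^d` with mean-zero velocity slices, and `E₁ ≥ 0`. There
are `T` with `0 < T ≤ L` and `Y` such that for EVERY `v₀ ∈ L²(T^d; ℝ^d)`, weakly divergence free
and mean zero with `‖∇v₀‖₂² ≤ E₁` (spectral enstrophy), there is a classical solution `(u, p)` of
NS_ν(F) on `(0, T] × T^d` with mean-zero slices, `‖∇u(t)‖₂² ≤ 2E₁ + 2` on `(0, T]`,
`∫ₛᵀ ‖Δu(t)‖₂² dt ≤ Y` for all `s ∈ (0, T]`, and `∫ ‖u(t) − v₀‖² → 0`, `‖∇(u(t) − v₀)‖₂² → 0` as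
`t → 0⁺`. [cite: RobinsonRodrigoSadowskiCUP2016, Thm 6.8 with Thm 7.5] -/
theorem _root_.Literature.Analysis.FunctionSpaces.Torus.IsClassicalNSSolutionOn.exists_forced_solution_of_eGradNormSq_le
    (hd : Fintype.card d = 3) {ν : ℝ} (hν : 0 < ν) {F : UnitAddTorus d → EuclideanSpace ℝ d}
    (hF : ∀ τ : ℝ, ∃ G : ℝ, ∀ R : ℕ, ∑ k ∈ Torus.freqBall R,
      Real.exp (τ * Real.sqrt (Torus.freqNormSq k)) ^ 2 *
        (Torus.freqNormSq k * ‖mFourierCoeff (EuclideanSpace.complexify ∘ F) k‖ ^ 2) ≤ G)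
    {L : ℝ} (hL : 0 < L) {ū : ℝ → UnitAddTorus d → EuclideanSpace ℝ d} {pbar : ℝ → UnitAddTorus d → ℝ}
    (hū : Torus.IsClassicalNSSolutionOn (Icc 0 L) ν (fun _ => F) ū pbar)
    (hūmean : ∀ t ∈ Icc 0 L, Torus.HasZeroMean (ū t)) {E₁ : ℝ} (hE₁ : 0 ≤ E₁) :
    ∃ T Y : ℝ, 0 < T ∧ T ≤ L ∧ ∀ v₀ : UnitAddTorus d → EuclideanSpace ℝ d, MemLp v₀ 2 volume →
      Torus.IsWeaklyDivFree v₀ → Torus.HasZeroMean v₀ → Torus.eGradNormSq v₀ ≤ ENNReal.ofReal E₁ →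
      ∃ (u : ℝ → UnitAddTorus d → EuclideanSpace ℝ d) (p : ℝ → UnitAddTorus d → ℝ),
        Torus.IsClassicalNSSolutionOn (Ioc 0 T) ν (fun _ => F) u p ∧
        (∀ t ∈ Ioc 0 T, Torus.HasZeroMean (u t)) ∧
        (∀ t ∈ Ioc 0 T, Torus.gradNormSq (u t) ≤ 2 * E₁ + 2) ∧
        (∀ s ∈ Ioc 0 T, ∫ t in s..T, (∫ x, ‖Torus.laplacian (u t) x‖ ^ 2) ≤ Y) ∧
        Tendsto (fun t => ∫ x, ‖u t x - v₀ x‖ ^ 2) (𝓝[>] 0) (𝓝 0) ∧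
        Tendsto (fun t => Torus.eGradNormSq (u t - v₀)) (𝓝[>] 0) (𝓝 0) := by
  haveI : Nonempty d := Fintype.card_pos_iff.1 (by rw [hd]; norm_num)
  -- constants: continuation span at level `E₁`, `V`-lifespan, `V`-stability on `[0, T₀]`
  obtain ⟨T₆, hT₆, -, hE6⟩ := hū.exists_forced_solution_of_gradNormSq_le hd hν hL hūmean E₁
  obtain ⟨T₂, hT₂, Y, hlife⟩ :=
    Torus.IsClassicalNSSolutionOn.enstrophy_lifespan (d := d) hd hν E₁ (Torus.gradNormSq F)
  set T₀ : ℝ := min (min T₆ T₂) (L / 2) with hT₀_def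
  have hT₀0 : 0 < T₀ := lt_min (lt_min hT₆ hT₂) (half_pos hL)
  have hT₀T₆ : T₀ ≤ T₆ := (min_le_left _ _).trans (min_le_left _ _)
  have hT₀T₂ : T₀ ≤ T₂ := (min_le_left _ _).trans (min_le_right _ _)
  have hT₀L : T₀ + L / 2 ≤ L := by linarith [min_le_right (min T₆ T₂) (L / 2)]
  obtain ⟨C₃, hC₃⟩ := Torus.IsClassicalNSSolutionOn.h1_sub_le_mul_of_integral_laplacian_sq_le (d := d)
    hd hν (2 * E₁ + 1) Y T₀ hT₀0
  obtain ⟨T₂', hT₂', Y', hlife'⟩ :=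
    Torus.IsClassicalNSSolutionOn.enstrophy_lifespan (d := d) hd hν (2 * E₁ + 1) (Torus.gradNormSq F)
  set T : ℝ := T₀ / 2 with hT_def
  have hT0 : 0 < T := half_pos hT₀0
  have hTT₀ : T < T₀ := half_lt_self hT₀0
  obtain ⟨n, hn⟩ := exists_nat_ge (T / T₂')
  refine ⟨T, n * max Y' 0, hT0, by linarith, fun v₀ hv₀ hdiv hmean hE => ?_⟩
  -- the data `v_N = P_N v₀`
  have hv₀i : Integrable v₀ volume := hv₀.integrable one_le_two
  have hH : Torus.eGradNormSq v₀ ≠ ⊤ := ne_top_of_le_ne_top ENNReal.ofReal_ne_top hE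
  set vN : ℕ → UnitAddTorus d → EuclideanSpace ℝ d := fun N => Torus.fourierTruncate N v₀ with hvN_def
  have hvNs : ∀ N, Torus.IsSmooth (vN N) := fun N => Torus.isSmooth_fourierTruncate N v₀
  have hvNE : ∀ N, Torus.gradNormSq (vN N) ≤ E₁ := fun N => by
    rw [Torus.gradNormSq_eq_toReal_eGradNormSq_holds (hvNs N)]
    have h1 : Torus.eGradNormSq (vN N) ≤ ENNReal.ofReal E₁ :=
      (Torus.eGradNormSq_fourierTruncate_le hv₀i N).trans hE
    have h2 := ENNReal.toReal_mono ENNReal.ofReal_ne_top h1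
    rwa [ENNReal.toReal_ofReal hE₁] at h2
  -- the approximants on `[0, T₀]`
  have happrox : ∀ N, ∃ (U : ℝ → UnitAddTorus d → EuclideanSpace ℝ d) (P : ℝ → UnitAddTorus d → ℝ),
      Torus.IsClassicalNSSolutionOn (Icc 0 T₀) ν (fun _ => F) U P ∧ U 0 = vN N ∧
      (∀ t ∈ Icc 0 T₀, Torus.HasZeroMean (U t)) ∧ (∀ t ∈ Icc 0 T₀, Torus.gradNormSq (U t) ≤ 2 * E₁ + 1) ∧
      ∀ t ∈ Icc 0 T₀, ∫ s in (0 : ℝ)..t, (∫ x, ‖Torus.laplacian (U s) x‖ ^ 2) ≤ Y := by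
    intro N
    obtain ⟨U, P, hsol, h0, hm, -⟩ := hE6 (vN N) (hvNs N) (Torus.isDivFree_fourierTruncate hv₀ hdiv N)
      (Torus.hasZeroMean_fourierTruncate hv₀i hmean N) (hvNE N)
    have hsol' := hsol.mono (Icc_subset_Icc le_rfl hT₀T₆) (uniqueDiffOn_Icc hT₀0)
    have hl := hlife hsol' hT₀0 (by rw [h0]; exact hvNE N) (fun _ _ => le_rfl)
    exact ⟨U, P, hsol', h0, fun t ht => hm t ⟨ht.1, ht.2.trans hT₀T₆⟩,
      fun t ht => hl.1 t ht (by linarith [ht.2]), fun t ht => hl.2 t ht (by linarith [ht.2])⟩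
  choose U P hU hU0 hUmean hUE hUY using happrox
  have hUs : ∀ N, ∀ t ∈ Icc 0 T₀, Torus.IsSmooth (U N t) := fun N t ht =>
    (hU N).smooth_velocity.isSmooth_slice ht
  -- the Cauchy modulus
  set ε : ℕ → ℝ := fun N => (∫ x, ‖vN N x - v₀ x‖ ^ 2) + (Torus.eGradNormSq (vN N - v₀)).toReal
    with hε_def
  have hε : Tendsto ε atTop (𝓝 0) := Torus.tendsto_h1Err_fourierTruncate hv₀ hH
  have hεnn : ∀ N, 0 ≤ ∫ x, ‖vN N x - v₀ x‖ ^ 2 := fun N => integral_nonneg fun _ => sq_nonneg _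
  have hε0 : ∀ N, 0 ≤ ε N := fun N => add_nonneg (hεnn N) ENNReal.toReal_nonneg
  set C : ℝ := 2 * max C₃ 0 with hC_def
  have hC0 : 0 ≤ C := by positivity
  have hpair : ∀ N M, ∀ t ∈ Icc 0 T₀, (∫ x, ‖U N t x - U M t x‖ ^ 2) +
      Torus.gradNormSq (fun x => U N t x - U M t x) ≤ C * (ε N + ε M) := by
    intro N M t ht
    have h := hC₃ (a := 0) (by rw [zero_add]; exact hU N) (by rw [zero_add]; exact hU M)
      (by rw [zero_add]; exact hUmean N) (by rw [zero_add]; exact hUmean M)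
      (by rw [zero_add]; exact hUE N) (by rw [zero_add]; exact hUE M)
      (by rw [zero_add]; exact hUY M T₀ ⟨hT₀0.le, le_rfl⟩) t (by rw [zero_add]; exact ht)
    rw [hU0 N, hU0 M] at h
    have hd0 : (∫ x, ‖vN N x - vN M x‖ ^ 2) + Torus.gradNormSq (fun x => vN N x - vN M x) ≤
        2 * ε N + 2 * ε M := Torus.h1DistSq_fourierTruncate_le hv₀ hH N M
    have hnn : 0 ≤ (∫ x, ‖vN N x - vN M x‖ ^ 2) + Torus.gradNormSq (fun x => vN N x - vN M x) :=
      add_nonneg (integral_nonneg fun _ => sq_nonneg _) (Torus.gradNormSq_nonneg _)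
    calc (∫ x, ‖U N t x - U M t x‖ ^ 2) + Torus.gradNormSq (fun x => U N t x - U M t x)
        ≤ C₃ * ((∫ x, ‖vN N x - vN M x‖ ^ 2) + Torus.gradNormSq (fun x => vN N x - vN M x)) := h
      _ ≤ max C₃ 0 * ((∫ x, ‖vN N x - vN M x‖ ^ 2) + Torus.gradNormSq (fun x => vN N x - vN M x)) :=
          mul_le_mul_of_nonneg_right (le_max_left _ _) hnn
      _ ≤ max C₃ 0 * (2 * ε N + 2 * ε M) := mul_le_mul_of_nonneg_left hd0 (le_max_right _ _)
      _ = C * (ε N + ε M) := by rw [hC_def]; ring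
  -- the limit slices and the solution on `(0, T₀)`
  obtain ⟨u, hu, hrate, hGev⟩ :=
    Torus.exists_limit_slices_of_h1Cauchy hd.le hν hF hU hUmean hUE hε hpair
  have hus : ∀ t ∈ Ioc 0 T₀, Torus.IsSmooth (u t) := fun t ht => (hu t ht).1
  have hconv : ∀ t ∈ Ioc 0 T₀, Tendsto (fun N => (∫ x, ‖U N t x - u t x‖ ^ 2) +
      Torus.gradNormSq (fun x => U N t x - u t x)) atTop (𝓝 0) := fun t ht =>
    tendsto_of_tendsto_of_tendsto_of_le_of_le tendsto_const_nhds
      (by simpa using hε.const_mul (2 * C))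
      (fun N => add_nonneg (integral_nonneg fun _ => sq_nonneg _) (Torus.gradNormSq_nonneg _))
      (hrate t ht)
  obtain ⟨p, hsol⟩ := hū.exists_pressure_of_limit_slices hd hν hūmean hT₀0 hT₀L hU hUmean hUE hus
    (fun t ht => (hu t ht).2.1) (fun t ht => (hu t ht).2.2.1) (fun t ht => (hu t ht).2.2.2) hconv hGev
  have hIocT : Ioc 0 T ⊆ Ioo 0 T₀ := fun t ht => ⟨ht.1, ht.2.trans_lt hTT₀⟩
  have hIocT' : Ioc 0 T ⊆ Ioc 0 T₀ := fun t ht => ⟨ht.1, ht.2.trans hTT₀.le⟩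
  have hsolT : Torus.IsClassicalNSSolutionOn (Ioc 0 T) ν (fun _ => F) u p :=
    hsol.mono hIocT (uniqueDiffOn_Ioc 0 T)
  refine ⟨u, p, hsolT, fun t ht => (hu t (hIocT' ht)).2.2.1,
    fun t ht => by linarith [(hu t (hIocT' ht)).2.2.2], ?_, ?_, ?_⟩
  · -- the dissipation budget on `[s, T]`
    have hsolI : ∀ s ∈ Ioo 0 T, Torus.IsClassicalNSSolutionOn (Icc s T) ν (fun _ => F) u p := fun s hs =>
      hsol.mono (fun t ht => ⟨hs.1.trans_le ht.1, ht.2.trans_lt hTT₀⟩) (uniqueDiffOn_Icc hs.2)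
    have hg : ∀ s ∈ Ioc 0 T, IntervalIntegrable (fun t => ∫ x, ‖Torus.laplacian (u t) x‖ ^ 2) volume s T := by
      intro s hs
      rcases hs.2.lt_or_eq with h | h
      · have hc := (((hsolI s ⟨hs.1, h⟩).smooth_velocity.laplacian (uniqueDiffOn_Icc h)).normSq
          ).continuousOn_integral (convex_Icc s T)
        exact hc.intervalIntegrable_of_Icc h.le
      · -- `rw` closes the goal `IntervalIntegrable _ volume T T` by `IntervalIntegrable.refl`
        rw [h]
    have hstep : ∀ s ∈ Ioc 0 T, ∀ t ∈ Icc s T, t ≤ s + T₂' →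
        ∫ r in s..t, (∫ x, ‖Torus.laplacian (u r) x‖ ^ 2) ≤ max Y' 0 := by
      intro s hs t ht hts
      rcases hs.2.lt_or_eq with h | h
      · have hl := hlife' (hsolI s ⟨hs.1, h⟩) h (hu s (hIocT' hs)).2.2.2 (fun _ _ => le_rfl)
        exact (hl.2 t ht hts).trans (le_max_left _ _)
      · have hts : t = s := le_antisymm (h ▸ ht.2) ht.1
        rw [hts, intervalIntegral.integral_same]
        exact le_max_right _ _
    intro s hs
    have hTn : T - s ≤ n * T₂' := by
      have h1 : T ≤ n * T₂' := (div_le_iff₀ hT₂').1 hn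
      linarith [hs.1]
    exact Torus.intervalIntegral_le_mul_of_forall_le hT₂' (le_max_right _ _) hg hstep n s hs hTn
  · -- attainment of the datum in `L²`
    rw [Metric.tendsto_nhds]
    intro δ hδ
    obtain ⟨N, hN⟩ := ((hε.const_mul (4 * C + 4)).eventually_lt_const (by simpa using half_pos hδ)
      |> fun h => (show ∀ᶠ N in atTop, (4 * C + 4) * ε N < δ / 2 by simpa using h)).exists
    have h0N := ((hU N).smooth_velocity.tendsto_integral_norm_sub_sq_nhdsGT hT₀0)
    rw [Metric.tendsto_nhds] at h0N
    filter_upwards [h0N (δ / 8) (by positivity), Ioc_mem_nhdsGT hT0] with t h1 ht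
    have ht' : t ∈ Ioc 0 T₀ := hIocT' ht
    have htI : t ∈ Icc 0 T₀ := ⟨ht'.1.le, ht'.2⟩
    rw [Real.dist_eq, sub_zero, abs_of_nonneg (integral_nonneg fun x => sq_nonneg _)] at h1 ⊢
    rw [hU0 N] at h1
    have hA := Torus.integral_norm_sub_sq_le_two_mul_of_memLp ((hus t ht').memLp 2)
      ((hUs N t htI).memLp 2) hv₀ (f := u t) (g := U N t) (h := v₀)
    have hB := Torus.integral_norm_sub_sq_le_two_mul_of_memLp ((hUs N t htI).memLp 2)
      ((hvNs N).memLp 2) hv₀ (f := U N t) (g := vN N) (h := v₀)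
    have hC' : ∫ x, ‖u t x - U N t x‖ ^ 2 ≤ 2 * C * ε N := by
      rw [Torus.integral_norm_sub_sq_comm]
      linarith [hrate t ht' N, Torus.gradNormSq_nonneg (fun x => U N t x - u t x)]
    have hD : ∫ x, ‖vN N x - v₀ x‖ ^ 2 ≤ ε N := le_add_of_nonneg_right ENNReal.toReal_nonneg
    nlinarith [hA, hB, hC', hD, h1, hN, hC0, hεnn N]
  · -- attainment of the datum in `Ḣ¹`
    refine ENNReal.tendsto_nhds_zero.2 fun η hη => ?_
    obtain ⟨r, -, hr0, hrη⟩ := ENNReal.lt_iff_exists_real_btwn.1 hη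
    have hr : 0 < r := ENNReal.ofReal_pos.1 hr0
    obtain ⟨N, hN⟩ := ((hε.const_mul (8 * C + 2)).eventually_lt_const (by simpa using half_pos hr)
      |> fun h => (show ∀ᶠ N in atTop, (8 * C + 2) * ε N < r / 2 by simpa using h)).exists
    have h0N := ((hU N).smooth_velocity.tendsto_gradNormSq_sub_nhdsGT hT₀0)
    rw [Metric.tendsto_nhds] at h0N
    filter_upwards [h0N (r / 16) (by positivity), Ioc_mem_nhdsGT hT0] with t h1 ht
    have ht' : t ∈ Ioc 0 T₀ := hIocT' ht
    have htI : t ∈ Icc 0 T₀ := ⟨ht'.1.le, ht'.2⟩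
    rw [Real.dist_eq, sub_zero, abs_of_nonneg (Torus.gradNormSq_nonneg _), hU0 N] at h1
    have hust := hus t ht'
    have hUst := hUs N t htI
    -- the three pieces
    set a : ℝ := Torus.gradNormSq (u t - U N t) with ha_def
    set b : ℝ := Torus.gradNormSq (vN N - U N t) with hb_def
    have ha0 : 0 ≤ a := Torus.gradNormSq_nonneg _
    have hb0 : 0 ≤ b := Torus.gradNormSq_nonneg _
    have haε : a ≤ 2 * C * ε N := by
      rw [ha_def, show u t - U N t = fun x => u t x - U N t x from rfl, Torus.gradNormSq_sub_comm]
      have h0 : 0 ≤ ∫ x, ‖U N t x - u t x‖ ^ 2 := integral_nonneg fun x => sq_nonneg _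
      linarith [hrate t ht' N]
    have hbr : b < r / 16 := by
      rw [hb_def, show vN N - U N t = fun x => vN N x - U N t x from rfl, Torus.gradNormSq_sub_comm]
      exact h1
    have e2 : ∀ x : ℝ, (2 : ℝ≥0∞) * ENNReal.ofReal x = ENNReal.ofReal (2 * x) := fun x => by
      rw [ENNReal.ofReal_mul zero_le_two, ENNReal.ofReal_ofNat]
    have h1' : Torus.eGradNormSq (vN N - u t) ≤ ENNReal.ofReal (2 * b + 2 * a) := by
      have h := Torus.eGradNormSq_sub_le ((hvNs N).sub hUst).integrable (hust.sub hUst).integrable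
      rw [show vN N - U N t - (u t - U N t) = vN N - u t by abel,
        Torus.eGradNormSq_eq_ofReal_gradNormSq (hust.sub hUst),
        Torus.eGradNormSq_eq_ofReal_gradNormSq ((hvNs N).sub hUst), e2 b,
        e2 a, ← ENNReal.ofReal_add (by linarith [hb0]) (by linarith [ha0])] at h
      exact h
    have h2' : Torus.eGradNormSq (vN N - v₀) ≤ ENNReal.ofReal (ε N) := by
      rw [← ENNReal.ofReal_toReal (Torus.eGradNormSq_fourierTruncate_sub_ne_top hv₀i hH N)]
      exact ENNReal.ofReal_le_ofReal (le_add_of_nonneg_left (hεnn N))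
    have h3 := Torus.eGradNormSq_sub_le ((hvNs N).integrable.sub hv₀i) ((hvNs N).sub hust).integrable
    rw [show vN N - v₀ - (vN N - u t) = u t - v₀ by abel] at h3
    calc Torus.eGradNormSq (u t - v₀)
        ≤ 2 * Torus.eGradNormSq (vN N - v₀) + 2 * Torus.eGradNormSq (vN N - u t) := h3
      _ ≤ 2 * ENNReal.ofReal (ε N) + 2 * ENNReal.ofReal (2 * b + 2 * a) := by gcongr
      _ = ENNReal.ofReal (2 * ε N + 2 * (2 * b + 2 * a)) := by
          rw [e2, e2,
            ← ENNReal.ofReal_add (mul_nonneg zero_le_two (hε0 N)) (by linarith [ha0, hb0])]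
      _ ≤ ENNReal.ofReal r := ENNReal.ofReal_le_ofReal (by nlinarith [haε, hbr, hN, hC0, hεnn N])
      _ ≤ η := hrη.le

end Literature.Analysis.FluidPDE

end
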